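import Literature.Analysis.Calculus.QuadraticMapZeroIsolation
import HarnessLib

/-!
# Nontrivial zeros of a quadratic map `x ↦ A x + Q x x` are the real eigen-directions of `v ↦ Φ⁻¹ (Q v v)`

`Literature/Analysis/Calculus`, companion file of `QuadraticMapZeroIsolation.lean` (everything proved; no definitions, no named facts).
For a quadratic map `G x = A x + Q x x` (`A : X →L Y` realised by `Φ : X ≃L Y`, `Q : X →L X →L Y` bounded bilinear) write
`N v := Φ⁻¹ (Q v v)` (homogeneous of degree two).  The elementary identity `A (c • v) + Q (c • v) (c • v) = Φ (c • v + c² • N v)` gives: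

* for `c ≠ 0`, `c • v` is a zero of `G` iff `N v = (-c⁻¹) • v` (`quadratic_zero_smul_iff_renorm_eq_smul`);
* hence the NONZERO zeros of `G` are exactly the rescalings `x = -(μ⁻¹) • v` of the «real eigen-directions» `N v = μ • v`, `μ ≠ 0`,
  `v ≠ 0` (`exists_ne_zero_quadratic_zero_iff_exists_renorm_eigen`), and along a unit eigen-direction the zero has norm `1/‖N v‖`
  (`norm_quadratic_zero_of_renorm_eigen_unit`).

This is the bookkeeping behind fixed-point («spectral renormalisation» / Petviashvili-type) iterations `v ↦ N v / ‖N v‖` for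
quadratic profile equations: a fixed direction of that map up to sign is an exact nonzero zero of `G`, with the amplitude read off
as `1/‖N v‖`; the iteration cannot return the trivial zero.  [cite: PelinovskyStepanyants2004, §1 (Petviashvili's iteration
`u ↦ M[u]^γ L⁻¹ u^p` for `L u = u^p`, stabilising factor; here `p = 2` with the amplitude factored out)]; the uniqueness/isolation
side is `QuadraticMapZeroIsolation.lean` [cite: Deuflhard2011, §2.1.1].  WHAT THIS IS NOT: no convergence statement for any
iteration; nothing about Navier–Stokes or about any particular truncation.
-/

noncomputable section

namespace Literature.Analysis.Calculus

variable {X Y : Type*} [NormedAddCommGroup X] [NormedSpace ℝ X] [NormedAddCommGroup Y] [NormedSpace ℝ Y]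

/-- **The scaling identity of a quadratic map.**  With `Φ : X ≃L Y` realising `A`,
`A (c • v) + Q (c • v) (c • v) = Φ (c • v + (c * c) • Φ⁻¹ (Q v v))`.
[cite: PelinovskyStepanyants2004, §1 (power nonlinearity `u^p` scales by `c^p`; here `p = 2`)] -/
theorem quadratic_apply_smul_eq (A : X →L[ℝ] Y) (Q : X →L[ℝ] X →L[ℝ] Y) (Φ : X ≃L[ℝ] Y)
    (hΦ : (Φ : X →L[ℝ] Y) = A) (c : ℝ) (v : X) :
    A (c • v) + Q (c • v) (c • v) = Φ (c • v + (c * c) • Φ.symm (Q v v)) := by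
  have hA : ∀ w : X, A w = Φ w := by
    intro w
    have h2 : (Φ : X →L[ℝ] Y) w = A w := by rw [hΦ]
    rw [ContinuousLinearEquiv.coe_coe] at h2
    exact h2.symm
  have hQ : Q (c • v) (c • v) = (c * c) • Q v v := by
    simp only [map_smul, FunLike.coe_smul, Pi.smul_apply, smul_smul]
  rw [hA, hQ, map_add, map_smul, map_smul, ContinuousLinearEquiv.apply_symm_apply]

/-- **A rescaled direction is a zero iff the direction is a real eigen-direction of the renormalisation map.**
For `c ≠ 0`: `A (c • v) + Q (c • v) (c • v) = 0 ↔ Φ⁻¹ (Q v v) = (-c⁻¹) • v`.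
[cite: PelinovskyStepanyants2004, §1 (fixed points of the renormalised map are the stationary solutions)] -/
theorem quadratic_zero_smul_iff_renorm_eq_smul (A : X →L[ℝ] Y) (Q : X →L[ℝ] X →L[ℝ] Y) (Φ : X ≃L[ℝ] Y)
    (hΦ : (Φ : X →L[ℝ] Y) = A) {c : ℝ} (hc : c ≠ 0) (v : X) :
    A (c • v) + Q (c • v) (c • v) = 0 ↔ Φ.symm (Q v v) = (-c⁻¹) • v := by
  rw [quadratic_apply_smul_eq A Q Φ hΦ c v, ContinuousLinearEquiv.map_eq_zero_iff]
  constructor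
  · intro h
    -- c • v + (c*c) • N = 0  ⇒  N = -(c*c)⁻¹ • (c • v) = (-c⁻¹) • v
    have hcc : c * c ≠ 0 := mul_ne_zero hc hc
    have h1 : (c * c) • Φ.symm (Q v v) = -(c • v) := eq_neg_of_add_eq_zero_right h
    have h2 : Φ.symm (Q v v) = (c * c)⁻¹ • (-(c • v)) := by
      rw [← h1, smul_smul, inv_mul_cancel₀ hcc, one_smul]
    rw [h2, smul_neg, smul_smul, ← neg_smul]
    congr 1
    field_simp
  · intro h
    rw [h, smul_smul, ← add_smul]
    have : c + c * c * -c⁻¹ = 0 := by field_simp; ring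
    rw [this, zero_smul]

/-- **Construction: a real eigen-direction gives a nonzero zero.**  If `Φ⁻¹ (Q v v) = μ • v` with `μ ≠ 0`, then
`x := (-μ⁻¹) • v` satisfies `A x + Q x x = 0`. [cite: PelinovskyStepanyants2004, §1] -/
theorem quadratic_zero_of_renorm_eigen (A : X →L[ℝ] Y) (Q : X →L[ℝ] X →L[ℝ] Y) (Φ : X ≃L[ℝ] Y)
    (hΦ : (Φ : X →L[ℝ] Y) = A) {μ : ℝ} (hμ : μ ≠ 0) {v : X} (hv : Φ.symm (Q v v) = μ • v) :
    A ((-μ⁻¹) • v) + Q ((-μ⁻¹) • v) ((-μ⁻¹) • v) = 0 := by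
  have hc : (-μ⁻¹ : ℝ) ≠ 0 := neg_ne_zero.mpr (inv_ne_zero hμ)
  rw [quadratic_zero_smul_iff_renorm_eq_smul A Q Φ hΦ hc v, hv]
  congr 1
  rw [inv_neg, inv_inv, neg_neg]

/-- **Nonzero zeros ↔ real eigen-directions.**  `x ↦ A x + Q x x` has a zero `x ≠ 0` iff the renormalisation map
`v ↦ Φ⁻¹ (Q v v)` has a real eigen-direction `Φ⁻¹ (Q v v) = μ • v` with `v ≠ 0`, `μ ≠ 0` (then `x = (-μ⁻¹) • v`; conversely a
zero `x ≠ 0` is itself an eigen-direction with `μ = -1`).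
[cite: PelinovskyStepanyants2004, §1 (stationary solutions as fixed points of the renormalised map)] -/
theorem exists_ne_zero_quadratic_zero_iff_exists_renorm_eigen (A : X →L[ℝ] Y) (Q : X →L[ℝ] X →L[ℝ] Y)
    (Φ : X ≃L[ℝ] Y) (hΦ : (Φ : X →L[ℝ] Y) = A) :
    (∃ x : X, x ≠ 0 ∧ A x + Q x x = 0) ↔
      ∃ v : X, v ≠ 0 ∧ ∃ μ : ℝ, μ ≠ 0 ∧ Φ.symm (Q v v) = μ • v := by
  constructor
  · rintro ⟨x, hx0, hx⟩
    refine ⟨x, hx0, -1, by norm_num, ?_⟩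
    have h := (quadratic_zero_smul_iff_renorm_eq_smul A Q Φ hΦ (one_ne_zero) x).mp (by simpa using hx)
    simpa using h
  · rintro ⟨v, hv0, μ, hμ, hv⟩
    refine ⟨(-μ⁻¹) • v, ?_, quadratic_zero_of_renorm_eigen A Q Φ hΦ hμ hv⟩
    exact smul_ne_zero (neg_ne_zero.mpr (inv_ne_zero hμ)) hv0

/-- **Amplitude read-off along a unit eigen-direction.**  If `‖v‖ = 1` and `Φ⁻¹ (Q v v) = μ • v`, the zero
`x = (-μ⁻¹) • v` has `‖x‖ = 1 / ‖Φ⁻¹ (Q v v)‖` (`= 1/|μ|`; both sides vanish when `μ = 0`, Lean's `0⁻¹ = 0`).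
[cite: PelinovskyStepanyants2004, §1 (the stabilising factor fixes the amplitude of the fixed point)] -/
theorem norm_quadratic_zero_of_renorm_eigen_unit (Q : X →L[ℝ] X →L[ℝ] Y) (Φ : X ≃L[ℝ] Y)
    {μ : ℝ} {v : X} (hv1 : ‖v‖ = 1) (hv : Φ.symm (Q v v) = μ • v) :
    ‖(-μ⁻¹) • v‖ = 1 / ‖Φ.symm (Q v v)‖ := by
  rw [hv, norm_smul, norm_smul, hv1, mul_one, mul_one, norm_neg, norm_inv, Real.norm_eq_abs, one_div]

/-- **Every nonzero zero lies on an eigen-direction of unit norm** (normalised form used by shape-sphere iterations): if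
`x ≠ 0` and `A x + Q x x = 0` then `v := ‖x‖⁻¹ • x` has `‖v‖ = 1` and `Φ⁻¹ (Q v v) = (-‖x‖⁻¹) • v`.
[cite: PelinovskyStepanyants2004, §1] -/
theorem renorm_eigen_unit_of_quadratic_zero (A : X →L[ℝ] Y) (Q : X →L[ℝ] X →L[ℝ] Y) (Φ : X ≃L[ℝ] Y)
    (hΦ : (Φ : X →L[ℝ] Y) = A) {x : X} (hx0 : x ≠ 0) (hx : A x + Q x x = 0) :
    ‖(‖x‖⁻¹ : ℝ) • x‖ = 1 ∧ Φ.symm (Q (‖x‖⁻¹ • x) (‖x‖⁻¹ • x)) = (-‖x‖⁻¹) • (‖x‖⁻¹ • x) := by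
  have hn : ‖x‖ ≠ 0 := norm_ne_zero_iff.mpr hx0
  refine ⟨by rw [norm_smul, norm_inv, norm_norm, inv_mul_cancel₀ hn], ?_⟩
  -- x = ‖x‖ • (‖x‖⁻¹ • x), so apply the scaling criterion with c = ‖x‖
  have hx' : A (‖x‖ • (‖x‖⁻¹ • x)) + Q (‖x‖ • (‖x‖⁻¹ • x)) (‖x‖ • (‖x‖⁻¹ • x)) = 0 := by
    rw [smul_smul, mul_inv_cancel₀ hn, one_smul]; exact hx
  exact (quadratic_zero_smul_iff_renorm_eq_smul A Q Φ hΦ hn _).mp hx'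

end Literature.Analysis.Calculus

end
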